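import Mathlib
import Literature.MathematicalPhysics.QuantumFieldTheory.Balaban1983to89.Setup
import Literature.MathematicalPhysics.QuantumFieldTheory.Balaban1983to89.B14Sect1Sets

/-!
# `Balaban1983to89.B14Sect1Repr` — T. Bałaban, *Convergent renormalization expansions for lattice gauge theories*,
# Commun. Math. Phys. **119** (1988) 243–285 [Balaban1988Convergent]: (1.2) p. 246 (the localized background field
# `U_{1,□′}(V)`, DEFINED over the determining-set map of [15]) and (1.6) p. 247 (the first-step representation of
# `ρ₁ = Tρ₀` after the decompositions (1.1), (1.4) and the gauge fixing (1.5), TYPED AS PRINTED over `Setup`)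

statement-level skeleton of published theorems with citation tags; proofs where landed; nothing here is a claim about the Yang–Mills mass gap

PDF held: `paper:balaban1988-cmp119-convergent-renormalization` (journal page = PDF page + 242); displays read on the x2
renders `…-p004-x2.png` (p. 246) and `…-p005-x2.png` (p. 247) of
`run/shared/lean/pub/pub-balaban/b2b-balaban-ref1/pages/1988-cmp119-convergent-renormalization/`.

CITATION HEADER (lean-in-tree rule).  WHAT IS REPRODUCED, verbatim.
* p. 246 [PDF 4]: *"For every L²M₂R₁-cube □′ contained in (P₀′^∼)ᶜ we construct the function U_{1,□′}(V) as
  U_{1,□′}(V) = U(𝐁₁(□′^{∼4}), M˙(Q₁^{s*}V)), (1.2) where 𝐁₁(□′^{∼4}) is the minimal determining set based on □′^{∼4},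
  and Q₁^{s*}V was introduced in (4.5.3) [18]. … The function in (1.2) depends on the field V restricted to □′^{∼4}."*
  — SKELETON row **B14.Eq1.2** ((1.3), the definition of `Q₁^{s*}V`, is row B14.Eq1.3 = r15's
  `BIJ85Sect2SurfaceAverages.BlockBonds.QsstarGroup`; the map `U(𝐁, ·)` is the minimal configuration of
  [Balaban1985Variational] Thm 1, row B11.Thm1, "taken in the axial gauge", p. 247).
* p. 246–247 [PDF 4–5], (1.1): *"1 = Σ_{P₀} Π_{□⊂P₀ᶜ} χ({sup_{p⊂□^∼}|U(∂p) − 1| < ε₀}) Π_{□⊂P₀} χ({sup_{p⊂□^∼}|U(∂p) − 1|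
  ≧ ε₀}) = Σ_{P₀} χ₀(P₀ᶜ)χ₀ᶜ(P₀)"*; (1.4): *"1 = Σ_{P₁} Π_{□′⊂P₁ᶜ} χ({sup_{p⊂□′^∼}|U_{1,□′}(V, ∂p) − 1| < ε₁L⁻²}) ·
  Π_{□′⊂P₁} χ({… ≧ ε₁L⁻²}) = Σ_{P₁} χ₁(P₁ᶜ)χ₁ᶜ(P₁), (1.4) where the sum is over sets P₁ ⊂ (P₀′^∼)ᶜ, which are unions
  of the L²M₂R₁-cubes, P₁ᶜ denotes the complement to (P₀′^∼)ᶜ"*; (1.5) the axial gauge fixing *"1 = Π_{y∈P₁¹}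
  Π_{x∈B(y), x≠y} ∫du(x) (1/z) χ({|U^u(y,x) − 1| < ε₀}) exp\[−(1/g₀²)\[1 − Re tr U^u(y,x)\]\]"*; and **(1.6)** p. 247
  [PDF 5]: *"We insert it under the integral, and we apply the Faddeev-Popov procedure. This yields the equality
  ρ₁(V) = Σ_{P₀P₁} χ₁ᶜ(P₁)χ₁(P₁ᶜ) ∫dU δ(ŪV⁻¹) χ₀ᶜ(P₀)χ₀(P₀ᶜ)χ_{Ax}(P₁¹)
  · exp\[−(1/g₀²) 𝐆(P₁¹, U) − (1/g₀²) A(U) − (L⁴ − 1)|P₁¹| log z − E\], (1.6) where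
  𝐆(P₁¹, U) = Σ_{y∈P₁¹} Σ_{x∈B(y), x≠y} \[1 − Re tr U(y,x)\]. (1.7)"* — SKELETON row **B14.Eq1.6** ((1.7) = `Setup`'s
  `gaugeFixFn`, row B14.Eq1.7; (1.1)/(1.4) = rows B14.Eq1.1/B14.Eq1.4, abstractly PROVED as `B14Sect1Sets.decompUnity`).

THE TYPED READING.  Everything printed that `Setup` models is CONCRETE here: the unit lattice `T₁ = Site P 0` with its
gauge fields `GaugeField P 0 G`, the coarse lattice `T^{(1)} = Site P 1` (fields `V : GaugeField P 1 G`), the blocks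
`B(y)` (`Setup.block`, `emb`), the averaged contour variables `U(y,x)` of (0.11) [I] (`Setup.ContourData.holTo`), the
gauge-fixing function 𝐆 (1.7) (`Setup.gaugeFixFn`), the Wilson action `A(U)` (`Setup.wilsonAction4`), the small-plaquette
characteristic function `χ({sup_{p∈S}|U(∂p) − 1| < δ})` (`Setup.chiSmall`), and the renormalization transformation
`(Tρ)(V) = ∫dU δ(ŪV⁻¹)ρ(U)` as an operator on densities (`T`, e.g. `Setup.RTOpI.T`).  What B14 §1 builds on top and
this file takes as DATA (`Sect1Data`): the two cube partitions of p. 245–246 (index types `Cube0` of LM₂R₀-cubes `□`,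
`Cube1` of L²M₂R₁-cubes `□′`, with the plaquette sets `p ⊂ □^∼`, `p ⊂ □′^∼`), the set operations `P₀ ↦ (P₀′^∼)ᶜ`
(`inCompl`) and `(P₀, P₁) ↦ P₁¹ = ((P₀′^∼)ᶜ∩(P₁′^{∼2})ᶜ)^{(1)}` (`P11`; their geometry is `…B14Sect1Sets`), and the
ingredients of (1.2): the determining sets `𝐁₁(□′^{∼4})` (`B1enl4`), the minimal-configuration map `U(𝐁, ·)` of
[15] (`Umap`), the map `M˙` (`Mdot`) and `Q₁^{s*}` of (1.3) (`Qsstar`).  With these, (1.2) is the DEFINITION `U1loc`,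
the characteristic functions χ₀, χ₀ᶜ, χ₁, χ₁ᶜ, χ_{Ax} are DEFINITIONS (`chi0`, `chi0c`, `chi1`, `chi1c`, `chiAx`;
χ_{Ax}(P₁¹) = the product of the characteristic functions of (1.5) after the Faddeev–Popov step, i.e. the SOFT axial
condition `|U(y,x) − 1| < ε₀`, `x ∈ B(y)∖{y}`, `y ∈ P₁¹`), the right-hand side of (1.6) is the DEFINITION `rho1Rhs`,
and the printed equality (1.6) for `ρ₁ = Tρ₀`, `ρ₀ = exp\[−(1/g₀²)A − E\]` ((0.2) p. 244), is the `Prop` `Eq16` —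
a CLAIM of the paper ("This yields the equality"), typed, NOT proved here (its proof = (1.1)·(1.4) inserted, linearity
of `T`, and the Faddeev–Popov identity of [I] (0.15)–(0.16) inside the `T`-integral — rows B14.Eq1.1/1.4/1.5,
B12.Eq0.15–0.16).  The exponent's `L⁴ − 1` is printed for `d = 4` (= `|B(y)| − 1`); typed as printed.
PROVED here: the concrete instances `eq11`/`eq14` of the decompositions of unity (1.1)/(1.4) for THESE χ's
(`Finset.prod_add`), and `rho1Rhs_nonneg`-type bookkeeping is not needed and not claimed.

WHAT IS NOT ASSERTED: anything about existence/uniqueness of `U(𝐁, ·)` (B11 Thm 1), the dependence sentence after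
(1.3), the values of `z`, `E`, or the validity of (1.6).  Mega-formalization `lit-balaban`, unit `lit-balaban-r11` gen 2
(Phase-1 typing of absent rows B14.Eq1.2 / B14.Eq1.6, lead ruling G.5-9 / ABSENT-RANKED 2026-08-21), HOME
`run/shared/lean/pub/lit-balaban/`.

## References
* [Balaban1988Convergent] T. Bałaban, Commun. Math. Phys. 119 (1988) 243–285, (1.1)–(1.7) pp. 246–247.
* [Balaban1985Variational] T. Bałaban, Commun. Math. Phys. 102 (1985) 277–309, Thm 1 p. 279 (the map `U(𝐁, ·)`).
-/

noncomputable section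

namespace Literature.MathematicalPhysics.QuantumFieldTheory.Balaban1983to89.B14.Sect1Repr

open Literature.MathematicalPhysics.QuantumFieldTheory.Balaban1983to89
open scoped BigOperators

/-! ## §0. The data of Sect. 1 on top of `Setup` -/

/-- The objects of [Balaban1988Convergent] §1, pp. 245–247, that live on top of `Setup`'s lattices, as DATA:
the LM₂R₀-cubes `□` (`Cube0`) and the L²M₂R₁-cubes `□′` (`Cube1`) of the unit lattice `T₁` with the plaquette sets
`{p ⊂ □^∼}`, `{p ⊂ □′^∼}` entering (1.1)/(1.4); `inCompl P₀` = the cubes `□′ ⊂ (P₀′^∼)ᶜ` (p. 246); `P11 P₀ P₁ = P₁¹ =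
((P₀′^∼)ᶜ∩(P₁′^{∼2})ᶜ)^{(1)} ⊂ T^{(1)}` (p. 246); the averaged contour variables `U(y,x)` of (0.11) [I] (`cd`); and the
ingredients of (1.2): determining sets (`DetSet`), the data `W` a determining set carries (`BData`), the
minimal-configuration map `U(𝐁, W)` of [15] Thm 1 in the axial gauge (`Umap`), `𝐁₁(□′^{∼4})` (`B1enl4`), `M˙` (`Mdot`)
and `Q₁^{s*}` of (1.3) (`Qsstar`). [cite: Balaban1988Convergent, (1.1)–(1.4) p.246] -/
structure Sect1Data (P : Params) (G : Type*) [GaugeGroup G] where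
  Cube0 : Type
  [fin0 : Fintype Cube0]
  [dec0 : DecidableEq Cube0]
  plaqT : Cube0 → Set (Plaq P 0)
  Cube1 : Type
  [fin1 : Fintype Cube1]
  [dec1 : DecidableEq Cube1]
  plaqT1 : Cube1 → Set (Plaq P 0)
  inCompl : Finset Cube0 → Finset Cube1
  P11 : Finset Cube0 → Finset Cube1 → Finset (Site P 1)
  cd : ContourData P 0 G
  DetSet : Type
  BData : Type
  Umap : DetSet → BData → GaugeField P 0 G
  B1enl4 : Cube1 → DetSet
  Mdot : GaugeField P 0 G → BData
  Qsstar : GaugeField P 1 G → GaugeField P 0 G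

variable {P : Params} {G : Type*} [GaugeGroup G]

/-- The family of LM₂R₀-cubes of a `Sect1Data` is finite (field `fin0`), registered so that `Σ_{P₀}` of (1.1)/(1.6)
elaborates. [folklore] -/
instance Sect1Data.instFintypeCube0 (D : Sect1Data P G) : Fintype D.Cube0 := D.fin0

/-- Decidable equality of LM₂R₀-cubes (field `dec0`), for the set differences `P₀ᶜ = univ ∖ P₀`. [folklore] -/
instance Sect1Data.instDecEqCube0 (D : Sect1Data P G) : DecidableEq D.Cube0 := D.dec0

/-- The family of L²M₂R₁-cubes of a `Sect1Data` is finite (field `fin1`). [folklore] -/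
instance Sect1Data.instFintypeCube1 (D : Sect1Data P G) : Fintype D.Cube1 := D.fin1

/-- Decidable equality of L²M₂R₁-cubes (field `dec1`), for `P₁ᶜ = (P₀′^∼)ᶜ ∖ P₁`. [folklore] -/
instance Sect1Data.instDecEqCube1 (D : Sect1Data P G) : DecidableEq D.Cube1 := D.dec1

/-! ## §1. (1.2): the localized background field -/

/-- **(1.2)** p. 246 [PDF 4], verbatim: *"U_{1,□′}(V) = U(𝐁₁(□′^{∼4}), M˙(Q₁^{s*}V)), (1.2) where 𝐁₁(□′^{∼4}) is the
minimal determining set based on □′^{∼4}, and Q₁^{s*}V was introduced in (4.5.3) [18]"* — the localized background field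
of the cube `□′` as a function of the new field `V`, DEFINED from the data `Umap`, `B1enl4`, `Mdot`, `Qsstar`.
[cite: Balaban1988Convergent, (1.2) p.246] -/
def U1loc (D : Sect1Data P G) (c : D.Cube1) (V : GaugeField P 1 G) : GaugeField P 0 G :=
  D.Umap (D.B1enl4 c) (D.Mdot (D.Qsstar V))

/-- p. 246, after (1.3): *"The function in (1.2) depends on the field V restricted to □′^{∼4}."* — typed as a predicate on
the data (`vars □′` = the bonds of `□′^{∼4}` in `T^{(1)}`); a CLAIM of the paper, recorded, not proved here.
[cite: Balaban1988Convergent, (1.2) p.246] -/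
def U1locDependsOn (D : Sect1Data P G) (vars : D.Cube1 → Set (PBond P 1)) : Prop :=
  ∀ (c : D.Cube1) (V W : GaugeField P 1 G), (∀ b ∈ vars c, V b = W b) → U1loc D c V = U1loc D c W

/-! ## §2. The characteristic functions of (1.1), (1.4), (1.6) -/

/-- `χ₀(X) = Π_{□⊂X} χ({sup_{p⊂□^∼}|U(∂p) − 1| < ε₀})` of (1.1) p. 246, over `Setup.chiSmall`. [cite: Balaban1988Convergent, (1.1) p.246] -/
def chi0 (D : Sect1Data P G) (ε₀ : ℝ) (X : Finset D.Cube0) : Density P 0 G :=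
  fun U => ∏ c ∈ X, chiSmall (D.plaqT c) ε₀ U

/-- `χ₀ᶜ(X) = Π_{□⊂X} χ({sup_{p⊂□^∼}|U(∂p) − 1| ≧ ε₀})` of (1.1) p. 246 (the complementary `0/1` function cube by cube).
[cite: Balaban1988Convergent, (1.1) p.246] -/
def chi0c (D : Sect1Data P G) (ε₀ : ℝ) (X : Finset D.Cube0) : Density P 0 G :=
  fun U => ∏ c ∈ X, (1 - chiSmall (D.plaqT c) ε₀ U)

/-- `χ₁(X)(V) = Π_{□′⊂X} χ({sup_{p⊂□′^∼}|U_{1,□′}(V, ∂p) − 1| < ε₁L⁻²})` of (1.4) p. 246 — small-field function of the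
LOCALIZED background (1.2). [cite: Balaban1988Convergent, (1.4) p.246] -/
def chi1 (D : Sect1Data P G) (ε₁ : ℝ) (X : Finset D.Cube1) : Density P 1 G :=
  fun V => ∏ c ∈ X, chiSmall (D.plaqT1 c) (ε₁ * ((P.L : ℝ) ^ 2)⁻¹) (U1loc D c V)

/-- `χ₁ᶜ(X)(V) = Π_{□′⊂X} χ({sup_{p⊂□′^∼}|U_{1,□′}(V, ∂p) − 1| ≧ ε₁L⁻²})` of (1.4) p. 246. [cite: Balaban1988Convergent, (1.4) p.246] -/
def chi1c (D : Sect1Data P G) (ε₁ : ℝ) (X : Finset D.Cube1) : Density P 1 G :=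
  fun V => ∏ c ∈ X, (1 - chiSmall (D.plaqT1 c) (ε₁ * ((P.L : ℝ) ^ 2)⁻¹) (U1loc D c V))

open Classical in
/-- `χ_{Ax}(Y)(U) = Π_{y∈Y} Π_{x∈B(y), x≠y} χ({|U(y,x) − 1| < ε₀})` — the characteristic functions of (1.5) p. 247 left in
(1.6) after the Faddeev–Popov step (the SOFT axial gauge condition on the blocks of `B(Y)`, `Y = P₁¹`).
[cite: Balaban1988Convergent, (1.5)–(1.6) p.247] -/
def chiAx (D : Sect1Data P G) (ε₀ : ℝ) (Y : Finset (Site P 1)) : Density P 0 G :=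
  fun U => ∏ y ∈ Y, ∏ x ∈ (block y).erase (emb y), if dist1 (D.cd.holTo U y x) < ε₀ then (1 : ℝ) else 0

/-- **(1.1)** for the concrete χ₀, χ₀ᶜ: `Σ_{P₀} χ₀(P₀ᶜ)(U) χ₀ᶜ(P₀)(U) = 1`, the sum over all unions `P₀` of LM₂R₀-cubes
(`P₀ᶜ = univ ∖ P₀`). PROVED (`Π_□ (χ_□ + (1 − χ_□)) = 1`, `Finset.prod_add`; the abstract form is
`B14Sect1Sets.decompUnity`). [cite: Balaban1988Convergent, (1.1) p.246] -/
theorem eq11 (D : Sect1Data P G) (ε₀ : ℝ) (U : GaugeField P 0 G) :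
    ∑ P0 ∈ (Finset.univ : Finset D.Cube0).powerset, chi0 D ε₀ (Finset.univ \ P0) U * chi0c D ε₀ P0 U = 1 := by
  unfold chi0 chi0c
  calc ∑ P0 ∈ (Finset.univ : Finset D.Cube0).powerset,
        (∏ c ∈ Finset.univ \ P0, chiSmall (D.plaqT c) ε₀ U) * ∏ c ∈ P0, (1 - chiSmall (D.plaqT c) ε₀ U)
      = ∑ P0 ∈ (Finset.univ : Finset D.Cube0).powerset,
          (∏ c ∈ P0, (1 - chiSmall (D.plaqT c) ε₀ U)) * ∏ c ∈ Finset.univ \ P0, chiSmall (D.plaqT c) ε₀ U :=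
        Finset.sum_congr rfl fun _ _ => mul_comm _ _
    _ = ∏ c ∈ (Finset.univ : Finset D.Cube0), ((1 - chiSmall (D.plaqT c) ε₀ U) + chiSmall (D.plaqT c) ε₀ U) :=
        (Finset.prod_add _ _ _).symm
    _ = 1 := Finset.prod_eq_one fun c _ => by ring

/-- **(1.4)** for the concrete χ₁, χ₁ᶜ on the domain `(P₀′^∼)ᶜ`: `Σ_{P₁ ⊂ (P₀′^∼)ᶜ} χ₁(P₁ᶜ)(V) χ₁ᶜ(P₁)(V) = 1`
(`P₁ᶜ = inCompl P₀ ∖ P₁`, "the complement to (P₀′^∼)ᶜ"). PROVED. [cite: Balaban1988Convergent, (1.4) p.246] -/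
theorem eq14 (D : Sect1Data P G) (ε₁ : ℝ) (P0 : Finset D.Cube0) (V : GaugeField P 1 G) :
    ∑ P1 ∈ (D.inCompl P0).powerset, chi1 D ε₁ (D.inCompl P0 \ P1) V * chi1c D ε₁ P1 V = 1 := by
  unfold chi1 chi1c
  set f : D.Cube1 → ℝ := fun c => chiSmall (D.plaqT1 c) (ε₁ * ((P.L : ℝ) ^ 2)⁻¹) (U1loc D c V) with hf
  calc ∑ P1 ∈ (D.inCompl P0).powerset, (∏ c ∈ D.inCompl P0 \ P1, f c) * ∏ c ∈ P1, (1 - f c)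
      = ∑ P1 ∈ (D.inCompl P0).powerset, (∏ c ∈ P1, (1 - f c)) * ∏ c ∈ D.inCompl P0 \ P1, f c :=
        Finset.sum_congr rfl fun _ _ => mul_comm _ _
    _ = ∏ c ∈ D.inCompl P0, ((1 - f c) + f c) := (Finset.prod_add _ _ _).symm
    _ = 1 := Finset.prod_eq_one fun c _ => by ring

/-! ## §3. (1.6): the first-step representation -/

/-- The density `ρ₀ = exp\[−(1/g₀²)A(U) − E\]` of (0.2) p. 244 (Wilson action `A` = `Setup.wilsonAction4`, vacuum-energy
constant `E`). [cite: Balaban1988Convergent, (0.2) p.244] -/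
def rho0 (g₀ E : ℝ) : Density P 0 G :=
  fun U => Real.exp (-(1 / g₀ ^ 2) * wilsonAction4 U - E)

/-- The integrand of (1.6) p. 247 under `∫dU δ(ŪV⁻¹)`, for given `P₀`, `P₁`:
`χ₀ᶜ(P₀) χ₀(P₀ᶜ) χ_{Ax}(P₁¹) exp\[−(1/g₀²)𝐆(P₁¹, U) − (1/g₀²)A(U) − (L⁴ − 1)|P₁¹| log z − E\]` (𝐆 = `Setup.gaugeFixFn`
(1.7), `A` = `Setup.wilsonAction4`; `L⁴ − 1` as printed, = `|B(y)| − 1` for `d = 4`). [cite: Balaban1988Convergent, (1.6) p.247] -/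
def integrand16 (D : Sect1Data P G) (g₀ ε₀ z E : ℝ) (P0 : Finset D.Cube0) (P1 : Finset D.Cube1) : Density P 0 G :=
  fun U => chi0c D ε₀ P0 U * chi0 D ε₀ (Finset.univ \ P0) U * chiAx D ε₀ (D.P11 P0 P1) U *
    Real.exp (-(1 / g₀ ^ 2) * gaugeFixFn D.cd (D.P11 P0 P1) U - (1 / g₀ ^ 2) * wilsonAction4 U
      - ((P.L : ℝ) ^ 4 - 1) * ((D.P11 P0 P1).card : ℝ) * Real.log z - E)

/-- **The right-hand side of (1.6)** p. 247 [PDF 5]: `Σ_{P₀P₁} χ₁ᶜ(P₁)χ₁(P₁ᶜ) ∫dU δ(ŪV⁻¹) χ₀ᶜ(P₀)χ₀(P₀ᶜ)χ_{Ax}(P₁¹)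
exp\[…\]`, the δ-integral being the renormalization transformation `T` applied to `integrand16` and evaluated at `V`;
`P₀` over all unions of LM₂R₀-cubes, `P₁` over the unions of L²M₂R₁-cubes inside `(P₀′^∼)ᶜ`.
[cite: Balaban1988Convergent, (1.6) p.247] -/
def rho1Rhs (D : Sect1Data P G) (T : Density P 0 G → Density P 1 G) (g₀ ε₀ ε₁ z E : ℝ) : Density P 1 G :=
  fun V => ∑ P0 ∈ (Finset.univ : Finset D.Cube0).powerset, ∑ P1 ∈ (D.inCompl P0).powerset,
    chi1c D ε₁ P1 V * chi1 D ε₁ (D.inCompl P0 \ P1) V * T (integrand16 D g₀ ε₀ z E P0 P1) V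

/-- **(1.6)** p. 247 [PDF 5], verbatim: *"We insert it under the integral, and we apply the Faddeev-Popov procedure.
This yields the equality ρ₁(V) = Σ_{P₀P₁} χ₁ᶜ(P₁)χ₁(P₁ᶜ) ∫dU δ(ŪV⁻¹) χ₀ᶜ(P₀)χ₀(P₀ᶜ)χ_{Ax}(P₁¹) ·
exp\[−(1/g₀²) 𝐆(P₁¹, U) − (1/g₀²) A(U) − (L⁴ − 1)|P₁¹| log z − E\], (1.6)"* — typed reading: for the renormalization
transformation `T` ((0.1), e.g. `Setup.RTOpI.T`), `ρ₁ = Tρ₀` equals `rho1Rhs` pointwise in `V`.  A printed CLAIM (its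
proof = (1.1)·(1.4)·(1.5) under the integral + Faddeev–Popov), typed, not proved here. [cite: Balaban1988Convergent, (1.6) p.247] -/
def Eq16 (D : Sect1Data P G) (T : Density P 0 G → Density P 1 G) (g₀ ε₀ ε₁ z E : ℝ) : Prop :=
  ∀ V : GaugeField P 1 G, T (rho0 g₀ E) V = rho1Rhs D T g₀ ε₀ ε₁ z E V

/-- Bookkeeping inside (1.6): at fixed `U`, inserting (1.1) multiplies `ρ₀(U)` by `Σ_{P₀} χ₀(P₀ᶜ)χ₀ᶜ(P₀) = 1` — the
integrand of `Tρ₀` equals `Σ_{P₀} χ₀ᶜ(P₀)χ₀(P₀ᶜ)ρ₀` pointwise (the step of the derivation of (1.6) that precedes (1.4),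
(1.5)). PROVED from `eq11`. [cite: Balaban1988Convergent, (1.1) p.246, (1.6) p.247] -/
theorem rho0_eq_sum_chi0 (D : Sect1Data P G) (g₀ ε₀ E : ℝ) (U : GaugeField P 0 G) :
    rho0 g₀ E U = ∑ P0 ∈ (Finset.univ : Finset D.Cube0).powerset,
      chi0c D ε₀ P0 U * chi0 D ε₀ (Finset.univ \ P0) U * rho0 g₀ E U := by
  rw [← Finset.sum_mul]
  conv_lhs => rw [← one_mul (rho0 g₀ E U)]
  congr 1
  rw [← eq11 D ε₀ U]
  exact Finset.sum_congr rfl fun _ _ => mul_comm _ _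

end Literature.MathematicalPhysics.QuantumFieldTheory.Balaban1983to89.B14.Sect1Repr
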